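import Literature.AlgebraicGeometry.Resolution.RegularLocalRingsQuotient
import Summits.ResolutionOfSingularities.ResolutionOfSingularities.Theorems.WeightedInvariantHypersurfaceLocalGameEFTCurveMoveLocalization
import HarnessLib

/-!
# The e.f.t. local weighted game (H2a′), curve move III: the CURVE MOVE drops the order (every dimension)

Topic: `Summits/ResolutionOfSingularities/ResolutionOfSingularities/Theorems`. Helper (part 3 of 3) for the door item
`HypersurfaceCentreConstruction` (statement `stmt-ResolutionOfSingularities-19897`, route `WeightedInvariant`);
kernel K2 = case A of the move table of `L/res-type-098-w43/EFT-DIM2-DESIGN.md` (ORDER (o13) of `res-L1-w43-plan-1`),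
for THE named rank `ι = iotaOrd` (res-type-073, p502169).

[OURS · L1 W4.3] Replaces the role of NO printed item; NOT a statement of the manuscript
[claim: Hironaka2017, status: under-review]. AI work, weaker than expert review.

## Statement proved

Let `S` be a regular local ring (any dimension), `π ∈ 𝔪 ∖ 𝔪²`, `0 ≠ f` with `π² ∣ f`; write `f = πᵉ f₂`, `π ∤ f₂`
(so `e ≥ 2`). The CURVE MOVE is the weighted move whose only positively weighted parameter is `π` (weight `1`):
`𝒥ₙ = (πⁿ)`, `B = S[t⁻¹, πt]`; it is ADMISSIBLE (`f ∈ P²` for every prime `P ∋ π`), and at EVERY prime `𝔫 ⊇ 𝔪B`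
of `B` off the vertex the `t⁻¹`-saturated transform is `g = (πt)ᵉ f₂` with `πt ∉ 𝔫`, whence

  `iotaOrd B_𝔫 g = ord_𝔪(f₂) = ord_𝔪(f) − e < ord_𝔪(f) = iotaOrd S f`

(`LocalGameEFTCurveMove.curveChart_iotaOrd_lt`; the hypotheses `t⁻¹ ∈ 𝔫` and `g ∈ 𝔪_{B_𝔫}²` of the H2a′ clause are
not used: the curve move never merely «keeps ι with a smooth successor», it DROPS). Consequences: the `∃`-clause of
`LocalWeightedDropEFT` for `ι = iotaOrd` at every position `(S, f)` with a repeated regular-parameter factor, given a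
regular system of parameters through `π` (`localGameEFT_clause_iotaOrd_of_sq_dvd`), and from `π` alone
(`localGameEFT_clause_iotaOrd_of_sq_dvd'`, via `exists_fin_cons_span_eq_maximalIdeal`). In dimension 1 this is the
non-vacuous reading of p499453; in dimension 2 it is case A of the rung; the remaining cases need point moves.

## References

* J. Włodarczyk, *Functorial resolution by torus actions*, arXiv:2203.03090, Def. 2.3.5, Lemma 4.6.1. [Wlodarczyk2022]
* O. Zariski, P. Samuel, *Commutative Algebra II*, Ch. VIII §1 (order valuation of a regular local ring).
  [ZariskiSamuel1960]
-/

noncomputable section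

open IsLocalRing Literature.AlgebraicGeometry.Resolution
open LaurentPolynomial
open scoped LaurentPolynomial
open Summit.ResolutionOfSingularities.ResolutionOfSingularities.Cruxes.HypersurfaceCentreConstruction.LocalEngine
  (iotaOrd iotaOrd_isoInvariant iotaOrd_unitInvariant iotaOrd_torusFactor_eq iotaOrd_eq_ordOfENat_adicOrder
    ordOfENat_strictMono)

set_option linter.dupNamespace false -- mandated namespace of this single-conjunct summit

namespace Summit.ResolutionOfSingularities.ResolutionOfSingularities.Theorems

namespace LocalGameEFTCurveMove

variable {S : Type} [CommRing S]

/-! ## Regular systems of parameters through a given `π ∈ 𝔪 ∖ 𝔪²` -/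

/-- In a Noetherian local ring an element `π ∈ 𝔪 ∖ 𝔪²` is the head of a minimal system of generators of `𝔪`
indexed by `Fin (k + 1)`, `k + 1 = spanFinrank 𝔪`. [folklore] -/
theorem exists_fin_cons_span_eq_maximalIdeal (S : Type) [CommRing S] [IsLocalRing S] [IsNoetherianRing S]
    {π : S} (hπ : π ∈ maximalIdeal S) (hπ2 : π ∉ (maximalIdeal S) ^ 2) :
    ∃ (k : ℕ) (v : Fin k → S), Ideal.span (Set.range (Fin.cons π v : Fin (k + 1) → S)) = maximalIdeal S ∧
      (maximalIdeal S).spanFinrank = k + 1 := by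
  classical
  obtain ⟨s, hsfin, hcard, hspan⟩ := exists_span_insert_eq_maximalIdeal hπ hπ2
  set t := hsfin.toFinset with ht
  refine ⟨t.card, fun i => ((t.equivFin.symm i : t) : S), ?_, ?_⟩
  · have hrange : Set.range (fun i : Fin t.card => ((t.equivFin.symm i : t) : S)) = s := by
      ext x
      simp only [Set.mem_range]
      constructor
      · rintro ⟨i, rfl⟩
        exact hsfin.mem_toFinset.mp (t.equivFin.symm i).2
      · intro hx
        exact ⟨t.equivFin ⟨x, hsfin.mem_toFinset.mpr hx⟩, by simp⟩
    rw [Fin.range_cons, hrange, hspan]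
  · have h1 : s.ncard = t.card := Set.ncard_eq_toFinset_card s hsfin
    have h2 : (maximalIdeal S).spanFinrank ≤ s.ncard + 1 := by
      rw [← hspan]
      exact (Submodule.spanFinrank_span_le_ncard_of_finite (hsfin.insert π)).trans (Set.ncard_insert_le π s)
    omega

/-! ## The drop of `ι = iotaOrd` under the curve move -/

section Drop

variable [IsRegularLocalRing S] {π : S} (hπ : π ∈ maximalIdeal S) (hπ2 : π ∉ (maximalIdeal S) ^ 2)
include hπ hπ2

/-- `ord_𝔪(π) = 1` for `π ∈ 𝔪 ∖ 𝔪²`. [folklore] -/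
theorem adicOrder_eq_one_of_not_mem_sq : adicOrder π = 1 := by
  refine le_antisymm ?_ ?_
  · exact (adicOrder_le_iff π 1).mpr (by simpa [one_add_one_eq_two] using hπ2)
  · exact_mod_cast (le_adicOrder_iff π 1).mpr (by rwa [pow_one])

/-- **The curve move drops the order at EVERY successor prime.** `S` regular local, `π ∈ 𝔪 ∖ 𝔪²`, `0 ≠ f`,
`π² ∣ f`; `B = S[t⁻¹, πt]` the algebra of the one-element chart `u = (π)`, `w = (1)`. For every prime `𝔫 ⊇ 𝔪B` of
`B` not containing the vertex ideal and every factorisation `f = t⁻ᵃ g`, `t⁻¹ ∤ g`: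
`iotaOrd B_𝔫 g < iotaOrd S f` (indeed `= ord_𝔪 f − v_π(f)`). The hypotheses `t⁻¹ ∈ 𝔫` and `g ∈ 𝔪_{B_𝔫}²` of
the H2a′ clause are not used. [OURS · L1 W4.3 · K2] -/
theorem curveChart_iotaOrd_lt (f : S) (hf0 : f ≠ 0) (hdiv : π ^ 2 ∣ f) :
    ∀ (𝔫 : Ideal (extReesAlgebra (weightedMonomialIdeal (fun _ : Fin 1 => π) (fun _ => 1)))) [𝔫.IsPrime],
      extReesAlgebra.tInv (weightedMonomialIdeal (fun _ : Fin 1 => π) (fun _ => 1)) ∈ 𝔫 →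
      (maximalIdeal S).map (algebraMap S
        (extReesAlgebra (weightedMonomialIdeal (fun _ : Fin 1 => π) (fun _ => 1)))) ≤ 𝔫 →
      ¬ (extReesAlgebra.vertexIdeal (weightedMonomialIdeal (fun _ : Fin 1 => π) (fun _ => 1)) ≤ 𝔫) →
      ∀ (a : ℕ) (g : extReesAlgebra (weightedMonomialIdeal (fun _ : Fin 1 => π) (fun _ => 1))),
        algebraMap S (extReesAlgebra (weightedMonomialIdeal (fun _ : Fin 1 => π) (fun _ => 1))) f =
          extReesAlgebra.tInv (weightedMonomialIdeal (fun _ : Fin 1 => π) (fun _ => 1)) ^ a * g →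
        ¬ (extReesAlgebra.tInv (weightedMonomialIdeal (fun _ : Fin 1 => π) (fun _ => 1)) ∣ g) →
        algebraMap _ (Localization.AtPrime 𝔫) g ∈ (maximalIdeal (Localization.AtPrime 𝔫)) ^ 2 →
        iotaOrd (Localization.AtPrime 𝔫) (algebraMap _ (Localization.AtPrime 𝔫) g) < iotaOrd S f := by
  haveI := isDomain_of_isRegularLocalRing S
  have hprime : Prime π := IsRegularLocalRing.prime_of_not_mem_sq hπ hπ2
  have hπ0 : π ≠ 0 := hprime.ne_zero
  obtain ⟨e, f₂, hf₂, hfe⟩ := WfDvdMonoid.max_power_factor hf0 hprime.irreducible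
  have hf₂0 : f₂ ≠ 0 := by rintro rfl; exact hf0 (by rw [hfe, mul_zero])
  -- `e ≥ 2`
  have he : 2 ≤ e := by
    by_contra hlt
    rw [not_le] at hlt
    rw [hfe] at hdiv
    interval_cases e
    · rw [pow_zero, one_mul] at hdiv
      exact hf₂ ((dvd_pow_self π two_ne_zero).trans hdiv)
    · rw [pow_one, pow_two, mul_dvd_mul_iff_left hπ0] at hdiv
      exact hf₂ hdiv
  intro 𝔫 _ _ h𝔪𝔫 hV a g hfg hndvd _
  have hT : piT π ∉ 𝔫 := piT_not_mem π hV
  rw [hfe] at hfg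
  obtain ⟨rfl, rfl⟩ := transform_eq hprime hf₂ hfg hndvd
  -- `(πt)ᵉ` is a unit of `B_𝔫`
  have hunit : IsUnit (algebraMap _ (Localization.AtPrime 𝔫) (piT π ^ a)) := by
    rw [map_pow]
    exact (IsLocalization.map_units _ (⟨piT π, hT⟩ : 𝔫.primeCompl)).pow a
  rw [map_mul, iotaOrd_unitInvariant (Localization.AtPrime 𝔫) _ _ hunit, iotaOrd_algebraMap_eq π hπ0 hT h𝔪𝔫 f₂,
    iotaOrd_eq_ordOfENat_adicOrder, iotaOrd_eq_ordOfENat_adicOrder]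
  apply ordOfENat_strictMono
  rw [hfe, adicOrder_mul, adicOrder_pow, adicOrder_eq_one_of_not_mem_sq hπ hπ2, mul_one]
  obtain ⟨k, hk⟩ := ENat.ne_top_iff_exists.mp (adicOrder_ne_top hf₂0)
  rw [← hk]
  exact_mod_cast (by omega : k < a + k)

end Drop

end LocalGameEFTCurveMove

/-! ## The `∃`-clause of `LocalWeightedDropEFT` for `ι = iotaOrd` at positions with a repeated smooth factor -/

/-- **Case A of the dim-2 rung, in every dimension.** `S` regular local with a regular system of parameters
`u : Fin d → S` (`(u) = 𝔪`, `d = spanFinrank 𝔪`) whose member `u i₀` lies off `𝔪²`; `0 ≠ f` with `(u i₀)² ∣ f`.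
Then the CURVE MOVE `(u, w = [· = i₀])` satisfies the `∀`-clause of `LocalWeightedDropEFT` for `ι = iotaOrd`:
`(u) = 𝔪`, `spanFinrank 𝔪 = d`, `0 < w i₀`, admissibility (`f ∈ P²` for `P ∋ u i₀`), and at every successor prime
the order DROPS (`curveChart_iotaOrd_lt`; the successor is never merely «smooth or equal»). [OURS · L1 W4.3 · K2] -/
theorem localGameEFT_clause_iotaOrd_of_sq_dvd (S : Type) [CommRing S] [IsRegularLocalRing S] {d : ℕ}
    (u : Fin d → S) (hu : Ideal.span (Set.range u) = maximalIdeal S) (hd : (maximalIdeal S).spanFinrank = d)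
    (i₀ : Fin d) (hπ2 : u i₀ ∉ (maximalIdeal S) ^ 2) (f : S) (hf0 : f ≠ 0) (hdiv : u i₀ ^ 2 ∣ f) :
    ∃ (n : ℕ) (u : Fin n → S) (w : Fin n → ℕ),
      Ideal.span (Set.range u) = maximalIdeal S ∧ (maximalIdeal S).spanFinrank = n ∧ (∃ i, 0 < w i) ∧
      (∀ (P : Ideal S) [P.IsPrime], (∀ i, 0 < w i → u i ∈ P) →
        algebraMap S (Localization.AtPrime P) f ∈ (maximalIdeal (Localization.AtPrime P)) ^ 2) ∧
      ∀ (𝔫 : Ideal (extReesAlgebra (weightedMonomialIdeal u w))) [𝔫.IsPrime],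
        extReesAlgebra.tInv (weightedMonomialIdeal u w) ∈ 𝔫 →
        (maximalIdeal S).map (algebraMap S (extReesAlgebra (weightedMonomialIdeal u w))) ≤ 𝔫 →
        ¬ (extReesAlgebra.vertexIdeal (weightedMonomialIdeal u w) ≤ 𝔫) →
        ∀ (a : ℕ) (g : extReesAlgebra (weightedMonomialIdeal u w)),
          algebraMap S (extReesAlgebra (weightedMonomialIdeal u w)) f =
            extReesAlgebra.tInv (weightedMonomialIdeal u w) ^ a * g →
          ¬ (extReesAlgebra.tInv (weightedMonomialIdeal u w) ∣ g) →
          algebraMap (extReesAlgebra (weightedMonomialIdeal u w)) (Localization.AtPrime 𝔫) g ∈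
            (maximalIdeal (Localization.AtPrime 𝔫)) ^ 2 →
          iotaOrd (Localization.AtPrime 𝔫)
              (algebraMap (extReesAlgebra (weightedMonomialIdeal u w)) (Localization.AtPrime 𝔫) g) <
            iotaOrd S f := by
  have hπ : u i₀ ∈ maximalIdeal S := hu ▸ Ideal.subset_span ⟨i₀, rfl⟩
  refine ⟨d, u, Pi.single i₀ 1, hu, hd, ⟨i₀, by simp⟩, ?_, ?_⟩
  · -- admissibility: `f ∈ (u i₀)² ⊆ P²`
    intro P _ hP
    have hπP : u i₀ ∈ P := hP i₀ (by simp)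
    obtain ⟨c, hc⟩ := hdiv
    have hfP : f ∈ P ^ 2 := by
      rw [hc]
      exact Ideal.mul_mem_right _ _ (Ideal.pow_mem_pow hπP 2)
    have := Ideal.mem_map_of_mem (algebraMap S (Localization.AtPrime P)) hfP
    rwa [Ideal.map_pow, Localization.AtPrime.map_eq_maximalIdeal] at this
  · rw [LocalGameEFTCurveMove.weightedMonomialIdeal_single_eq_one u i₀]
    exact LocalGameEFTCurveMove.curveChart_iotaOrd_lt hπ hπ2 f hf0 hdiv

/-- **Case A from `π` alone**: `S` regular local, `π ∈ 𝔪 ∖ 𝔪²`, `0 ≠ f`, `π² ∣ f` ⇒ the `∃`-clause of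
`LocalWeightedDropEFT` for `ι = iotaOrd` (extend `π` to a regular system of parameters,
`exists_fin_cons_span_eq_maximalIdeal`, and apply `localGameEFT_clause_iotaOrd_of_sq_dvd`). [OURS · L1 W4.3 · K2] -/
theorem localGameEFT_clause_iotaOrd_of_sq_dvd' (S : Type) [CommRing S] [IsRegularLocalRing S]
    {π : S} (hπ : π ∈ maximalIdeal S) (hπ2 : π ∉ (maximalIdeal S) ^ 2)
    (f : S) (hf0 : f ≠ 0) (hdiv : π ^ 2 ∣ f) :
    ∃ (n : ℕ) (u : Fin n → S) (w : Fin n → ℕ),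
      Ideal.span (Set.range u) = maximalIdeal S ∧ (maximalIdeal S).spanFinrank = n ∧ (∃ i, 0 < w i) ∧
      (∀ (P : Ideal S) [P.IsPrime], (∀ i, 0 < w i → u i ∈ P) →
        algebraMap S (Localization.AtPrime P) f ∈ (maximalIdeal (Localization.AtPrime P)) ^ 2) ∧
      ∀ (𝔫 : Ideal (extReesAlgebra (weightedMonomialIdeal u w))) [𝔫.IsPrime],
        extReesAlgebra.tInv (weightedMonomialIdeal u w) ∈ 𝔫 →
        (maximalIdeal S).map (algebraMap S (extReesAlgebra (weightedMonomialIdeal u w))) ≤ 𝔫 →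
        ¬ (extReesAlgebra.vertexIdeal (weightedMonomialIdeal u w) ≤ 𝔫) →
        ∀ (a : ℕ) (g : extReesAlgebra (weightedMonomialIdeal u w)),
          algebraMap S (extReesAlgebra (weightedMonomialIdeal u w)) f =
            extReesAlgebra.tInv (weightedMonomialIdeal u w) ^ a * g →
          ¬ (extReesAlgebra.tInv (weightedMonomialIdeal u w) ∣ g) →
          algebraMap (extReesAlgebra (weightedMonomialIdeal u w)) (Localization.AtPrime 𝔫) g ∈
            (maximalIdeal (Localization.AtPrime 𝔫)) ^ 2 →
          iotaOrd (Localization.AtPrime 𝔫)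
              (algebraMap (extReesAlgebra (weightedMonomialIdeal u w)) (Localization.AtPrime 𝔫) g) <
            iotaOrd S f := by
  obtain ⟨k, v, hspan, hrank⟩ := LocalGameEFTCurveMove.exists_fin_cons_span_eq_maximalIdeal S hπ hπ2
  exact localGameEFT_clause_iotaOrd_of_sq_dvd S (Fin.cons π v) hspan hrank 0 (by simpa using hπ2) f hf0
    (by simpa using hdiv)

end Summit.ResolutionOfSingularities.ResolutionOfSingularities.Theorems

end
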